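import Summits.QuantumFields.YangMills.Theorems.UnitScaleTiltHalvingStubOfHP1Room
import Summits.QuantumFields.YangMills.Theorems.UnitScaleTiltHalvingStepOfPillarsCERowsStatGrowth
import HarnessLib

/-!
# Route `UnitScaleTilt`, crux K1 child «MinimiserStabilityRegPr» (stmt-QuantumFields-19200), registered stub `stub_halvingStep` (v10 `BirthV10`) —
# **LEAD-H g6 SMALL-`Cr` EXIT (prefix «ρ4» = ρ3 + `4 < Cr`): THE ONE-HYPOTHESIS H DOOR** — `stub_halvingStep_of_hP1roomρ4 (hP1roomρ4) : <BirthV10.stub_halvingStep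
# VERBATIM>`, the byte-twin of ✓`HalvingStubOfHP1RoomRho3.stub_halvingStep_of_hP1roomρ3` (LEAD-H g5, RULING L-11 v3) whose displayed text `hP1roomρ4` carries ONE more
# antecedent, `4 < Cr →` right after `0 < Cr →`.  The door pays nothing: at its only instantiation site (§1, ✓p653154 :276) `Cr := 4C′B₀B₃` with `8 ≤ Cr` already in
# hand (`hCr8`), so `hCr4 : 4 < Cr` — which ✓p653154 proved two lines LATER for the stub's `4 < B₃` — is simply moved before the call and handed over.
# WHY the suppliers want it (LEAD-H LOCATE-H42-TOP §2 (ii), bus 20:54Z WORD 2 (3)): the ε₁-route of the top-level (1.42) row closes `H42L` at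
# `t := 2·d(M′+ρ′)·ε₁` (✓`HalvingHSiteTopH42Datum.htop_of_knitGauge`) under the windows `6(M′+ρ′)ε₁ < 6Lα₁ − C·α₂²`, `6(M′+ρ′)ε₁ ≤ 1`; the member prefix gives
# `Cr·ε₁ ≤ ε₀`, so `4 < Cr ⇒ ε₁ ≤ ε₀∕4` and both are window arithmetic, whereas `0 < Cr` alone bounds nothing.

Cell `ym3-torus` (HUMAN RULING D-0037, YM ladder rung R3 — YM₃ on T³ is a RUNG, not the Clay problem), width seat `ym-ust-19200-w5` gen 6 (LEAD-H g6).
`--supports stmt-QuantumFields-19200 --as helper`; count-neutral; def-free, 0 sorry, standard axioms.  `hP1roomρ4` is a HYPOTHESIS; nothing here claims the stub, the crux,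
the rung or the mass gap; no summit statement is proved by this seat.
* §1 ★★ `roomHalvingStat_of_rows_rho4 (hP2) (hP1roomρ4) (hCEgrowth)` : ✓`roomHalvingStat_of_rows_rho3`'s conclusion VERBATIM — its proof VERBATIM with `hCr4` moved up.
* §2 ★★★ **`stub_halvingStep_of_hP1roomρ4 (hP1roomρ4) : <stub VERBATIM>`** — H-SMALL lift ✓`statLift`, P2 ✓`hP2_holds`, growth-exposed C_E ✓`ceRows_of_chart_stat_growth_room`
  discharged by name.  After this file and ✓`HalvingP1FlatPillarRoomOfSuppliersRho4.hP1roomρ4_of_suppliers` ∕ ✓`HalvingHSupURho4OfMemberPacks.hSupUρ4_of_memberPacks`: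
  «stub ⟸ PACK₄(K−n=1) ∧ PACK₄(2≤K−n)» BY KERNEL — the chain the packs v2 (with `H42L` closed) feed.
INHABITABILITY (OWNER №9 (3)): `hP1roomρ4` is WEAKER than ✓p653154's `hP1roomρ3` (one more antecedent) — inhabited by ✓`hP1roomρ3_of_suppliers` already; door side — kernel.
HONEST SCOPE.  Assembly only (✓p653154 adapted by one binder); NOT a claim about the stub, the crux, the rung or the mass gap.

References: T. Bałaban, CMP **102** (1985) 277–309 [Balaban1985Variational] (111) p.294, (141)–(144) p.300, (152)–(168) pp.301–304, Prop. 8 p.304; CMP **99** (1985)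
75–102 [Balaban1985RegularSpaces] Thm 2 p.83, (1.33)–(1.38) p.82, (1.65)–(1.66) p.87, (1.140) p.100.
-/

set_option autoImplicit false

noncomputable section

open scoped BigOperators Matrix.Norms.L2Operator

namespace Summit.QuantumFields.YangMills.Theorems.HalvingStubOfHP1RoomRho4

open Literature.MathematicalPhysics.QuantumFieldTheory.Balaban1983to89
open Literature.MathematicalPhysics.QuantumFieldTheory.Balaban1983to89.T3ContinuumYM3Torus
open Literature.MathematicalPhysics.QuantumFieldTheory.Balaban1983to89.T3PrintedRegularMinimiser
open Literature.MathematicalPhysics.QuantumFieldTheory.Balaban1983to89.T3PrintedMinimiserExistence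
open Literature.MathematicalPhysics.QuantumFieldTheory.Balaban1983to89.T3Thm1Carrier
open Literature.MathematicalPhysics.QuantumFieldTheory.Balaban1983to89.T3Thm1CarrierNative (IsCritR2)
open Literature.MathematicalPhysics.QuantumFieldTheory.Balaban1983to89.T3UnitLawDensityEML (ℰp)
open Literature.MathematicalPhysics.QuantumFieldTheory.Balaban1983to89.T3ConstrainedMinimiser (fibre)
open Complex (I)
open B5Eq117TorusCarriers (Mk)
open B5Eq118OneStroke (iterBlockOf)
open B5Prop12FieldsLattice (distSite distSite_self)
open B6SectADomainsV1 (Domains)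
open B6SectAOperatorsV1 (BondIdx SiteIdx)
open B7Prop1Explicit (expUnit)
open B7Eq92Concrete (mgauge)
open B8Ineq132 (BondTouches)
open B8Eq140Level (SideTouches sideTouches_mono Cond140)
open B8Eq143PlaqExpansion (pdiv)
open B8Eq146AExpansion (plaqCovDeriv)
open B8Eq184Proof (cfgExp)
open B8Thm2SetupTorus (cfgPull gaugePull pullDom)
open B10Eq27TorusAxialLog (pull unitsField toUField transl)
open B11Eq115Space (levOf)
open LatticeFieldCalculus (bondAvgIter laplace diverg siteAvgIter)
open FlatCubeOpsText (Adm22 IsLevWeight FlatOpsAdmAtMS)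
open FlatCubeSequenceAligned (cubeSeqMT3)
open FlatCubeSequenceAdm (adm22_cubeSeqMT3)
open FlatOpsLettersAssembly (flatH isFlatH_flatH)
open HalvingQuarterCubeSeq (inOm_top_of_dist)
open HalvingP1FlatPillar (DP1Clause P1FlatPillarAt P1FlatPillar)
open HalvingP1FlatPillarPrime (P1FlatPillarAt' P1FlatPillar' sideTouches_subset_cube0)
open HalvingStepOfPillars (layerChart_of_memberChart)
open HalvingAssemblyInterior (siteClause_of_pieces_int)
open HalvingStepOfPillarsRoom (regPrHalving_of_memberCharts)
open FlatCubeSequenceAligned (cubeSetM)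
open HalvingSitePackage (sitePackage_of_rows)
open Summit.QuantumFields.YangMills.Theorems.Prop8ChartDoubleBar (chartLogFlat)
open HalvingRhoLinearBricks (exists_rho_163_pow package_const_le)
open HalvingSitePackage (ceRows_of_chart_stat_growth_room)

/-! ## §1 The room halving in stationarity currency from the three displayed texts, ρ-window edition + `4 < Cr` -/

section Door

/-- ★★ **THE ROOM HALVING, STATIONARITY CURRENCY, FROM THE THREE DISPLAYED TEXTS — ρ-WINDOW EDITION v3 + `4 < Cr`** (prefix «ρ4»):
✓`HalvingStubOfHP1RoomRho3.roomHalvingStat_of_rows_rho3` with `hP1roomρ3 ↦ hP1roomρ4` (one more antecedent `4 < Cr`, discharged at `Cr := 4C′B₀B₃ ≥ 8`); conclusion and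
proof VERBATIM (✓p653154), `hCr4` moved before the `hP1L` call.
[cite: Balaban1985Variational, (111) p.294, (144) p.300, (152)-(168) pp.301-304, Prop. 8 p.304; Balaban1985RegularSpaces, Thm 2 p.83, (1.33)-(1.38) p.82, (1.140) p.100] -/
theorem roomHalvingStat_of_rows_rho4
    (hP2 : ∀ L : ℕ, Odd L → 1 < L → ∃ (R₀ M₀ : ℕ) (B₀ δ₀ B₃ : ℝ), 0 < B₀ ∧ 0 < δ₀ ∧ 0 < B₃ ∧ FlatOpsAdmAtMS L R₀ M₀ B₀ δ₀ B₃)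
    (hP1roomρ4 : ∀ L : ℕ, Odd L → 1 < L → ∃ (Mₚ Rₚ : ℕ), ∀ (R M aₑ S : ℕ) (hM : 1 ≤ M), M = L ^ aₑ → Mₚ ≤ M → Rₚ ≤ R → R * M ≤ S →
      ∃ B₁ : ℝ, 0 ≤ B₁ ∧ ∃ Nr : ℕ, ∃ Cρ : ℝ, 0 < Cρ ∧ ∃ qρ : ℕ,
      ∀ (ρ : ℕ) (a Cr : ℝ), 0 < Cr → 4 < Cr → 12 * ((ρ : ℝ) + (M : ℝ)) * a ≤ Cr →
        16 * 3800 * ((5 * L : ℕ) : ℝ) ^ 2 * (L : ℝ) * ((B₁ * ((ρ : ℝ) + 1) ^ qρ + 1) * a) ≤ 1 → Cρ * ((ρ : ℝ) + 1) ^ qρ * a ≤ 1 →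
        ∀ F : T3Family, F.L = L → ∀ (n K : ℕ) (hnK : n < K), 2 * ρ + Nr ≤ F.L ^ (F.m + n) →
          ∀ (ε₀ ε₁ : ℝ), 0 < ε₁ → 0 < ε₀ → ε₀ ≤ a → Cr * ε₁ ≤ ε₀ →
          ∀ V : GaugeField (F.P n) 0 (Matrix.specialUnitaryGroup (Fin 2) ℂ), PlaqSmall ε₁ V →
            ∀ U ∈ regFibrePr F n K hnK.le ε₀ V, ∀ x : Site (F.P K) 0,
              P1FlatPillarAt' F n K (cubeSeqMT3 F n K x ρ S M hM) (cubeSetM x (K - n) ρ S M 0) x ε₀ ε₁ (B₁ * ((ρ : ℝ) + 1) ^ qρ) 6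
                (8 * (L : ℝ) * (B₁ * ((ρ : ℝ) + 1) ^ qρ + 1)) U)
    (hCEgrowth : ∀ L : ℕ, Odd L → 1 < L → ∀ (R₀ M₀ : ℕ) (B₀ δ₀ B₃ : ℝ), 0 < B₀ → 0 < δ₀ → 0 < B₃ → FlatOpsAdmAtMS L R₀ M₀ B₀ δ₀ B₃ →
      ∃ (M₁ R₁ : ℕ), ∀ (R M aₑ S : ℕ) (hM : 1 ≤ M), M = L ^ aₑ → M₁ ≤ M → M₀ ≤ M → R₁ ≤ R → R₀ ≤ R → R * M ≤ S →
      ∃ (Nce : ℕ) (k₁ k₂ c₂ ace : ℝ), 0 ≤ k₁ ∧ 0 ≤ k₂ ∧ 0 ≤ c₂ ∧ 0 < ace ∧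
      ∀ B₁ : ℝ, 0 ≤ B₁ →
      ∀ ρ : ℕ, 1 ≤ ρ → ∀ F : T3Family, F.L = L → ∀ (n K : ℕ) (hnK : n < K), Nce ≤ F.L ^ (F.m + n) →
        ∀ (ε₀ ε₁ : ℝ), 0 < ε₁ → 0 < ε₀ → ε₀ ≤ ace / (B₁ + 1) →
        ∀ V : GaugeField (F.P n) 0 (Matrix.specialUnitaryGroup (Fin 2) ℂ), PlaqSmall ε₁ V →
          ∀ U ∈ regFibrePr F n K hnK.le ε₀ V,
            (∀ γ : ℝ → GaugeField (F.P K) 0 (Matrix.specialUnitaryGroup (Fin 2) ℂ), γ 0 = U → (∀ t, γ t ∈ fibre F ℰp n K hnK.le V) →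
              (∀ b, DifferentiableAt ℝ (fun t => ((γ t b : Matrix.specialUnitaryGroup (Fin 2) ℂ) : Matrix (Fin 2) (Fin 2) ℂ)) 0) →
                deriv (fun t => wilsonAction4 (γ t)) 0 = 0) →
            ∀ (x : Site (F.P K) 0) (C₂' : ℝ) (u : GaugeTransf (F.P K) 0 (Matrix.unitaryGroup (Fin 2) ℂ)) (A : PBond (F.P K) 0 → Matrix (Fin 2) (Fin 2) ℂ),
              -- the seven conjuncts of `P1FlatPillarAt' F n K (cubeSeqMT3 …) (cubeSetM x (K−n) ρ S M 0) x ε₀ ε₁ B₁ 6 C₂' U` for THIS pair `(u, A)` ((ii′) on `□₀`)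
              DP1Clause F n K (cubeSeqMT3 F n K x ρ S M hM) x U u →
              (∀ b : PBond (F.P K) 0, IsSelfAdjoint (A b)) → (∀ b : PBond (F.P K) 0, Matrix.trace (A b) = 0) →
              (∀ (z : B7Prop1Explicit.Site (F.P K).d) (μ : Fin (F.P K).d),
                transl (0 : Site (F.P K) 0) z ∈ cubeSetM x (K - n) ρ S M 0 → (transl (0 : Site (F.P K) 0) z).shift μ ∈ cubeSetM x (K - n) ρ S M 0 →
                (Unitary.toUnits (u (transl 0 z)))⁻¹ * unitsField (toUField U) ⟨transl 0 z, μ⟩ * Unitary.toUnits (u ((transl 0 z).shift μ)) =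
                  expUnit (I • ((((F.L : ℝ)⁻¹) ^ (K - n)) • A ⟨transl 0 z, μ⟩))) →
              (∀ w : ℕ → PBond (F.P K) 0 → ℝ, IsLevWeight F n K (cubeSeqMT3 F n K x ρ S M hM) w →
                (∀ b : PBond (F.P K) 0, w 1 b * ‖A b‖ ≤ B₁ * ε₀) ∧
                (∀ (b : PBond (F.P K) 0) (ν : Fin (F.P K).d), w 2 b * (F.L : ℝ) ^ (K - n) * ‖A ⟨b.src.shift ν, b.dir⟩ - A b‖ ≤ B₁ * ε₀)) →
              (∃ μ : SiteIdx (cubeSeqMT3 F n K x ρ S M hM) → Matrix (Fin 2) (Fin 2) ℂ, ∀ s : Site (F.P K) 0,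
                laplace ((F.L : ℝ) ^ (K - n)) (diverg ((F.L : ℝ) ^ (K - n)) A) s =
                  ∑ i : SiteIdx (cubeSeqMT3 F n K x ρ S M hM), siteAvgIter (i.1.1 : ℕ) (Pi.single s (1 : ℝ)) i.1.2 • μ i) →
              (∀ c : BondIdx (cubeSeqMT3 F n K x ρ S M hM), (c.1.1 : ℕ) = K - n →
                c.1.2.src ∈ (cubeSeqMT3 F n K x ρ S M hM).Om (c.1.1 : ℕ) → c.1.2.tgt ∈ (cubeSeqMT3 F n K x ρ S M hM).Om (c.1.1 : ℕ) →
                ‖chartLogFlat (((F.L : ℝ)⁻¹) ^ (K - n)) (cubeSeqMT3 F n K x ρ S M hM) A c‖ ≤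
                  6 * ε₁ * (distSite (Mk (F.P K) (c.1.1 : ℕ)) c.1.2.src (iterBlockOf (c.1.1 : ℕ) x) + 1)) →
              (∀ c : BondIdx (cubeSeqMT3 F n K x ρ S M hM), ‖chartLogFlat (((F.L : ℝ)⁻¹) ^ (K - n)) (cubeSeqMT3 F n K x ρ S M hM) A c‖ ≤ C₂' * ε₀) →
              -- OUTPUT: `sitePackage_of_rows`'s rows for some `Hs`, `C`, `e₁`, `e₃`
              ∃ (Hs : (BondIdx (cubeSeqMT3 F n K x ρ S M hM) → Matrix (Fin 2) (Fin 2) ℂ) → (PBond (F.P K) 0 → Matrix (Fin 2) (Fin 2) ℂ))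
                (C : (PBond (F.P K) 0 → Matrix (Fin 2) (Fin 2) ℂ) → (BondIdx (cubeSeqMT3 F n K x ρ S M hM) → Matrix (Fin 2) (Fin 2) ℂ))
                (e₁ e₃ : ℝ),
                ((∀ (z : B7Prop1Explicit.Site (F.P K).d) (τ : Fin (F.P K).d),
                    SideTouches (pullDom (fun j => if K - n ≤ j then ({x} : Set (Site (F.P K) 0)) else (∅ : Set (Site (F.P K) 0))) (K - n)) z τ →
                    ‖((A + Hs (C A)) - fun b : PBond (F.P K) 0 => ∑ c, flatH F n K (cubeSeqMT3 F n K x ρ S M hM) (Pi.single c 1) b •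
                        bondAvgIter (c.1.1 : ℕ) (A + Hs (C A)) c.1.2) ⟨transl 0 z, τ⟩‖ ≤ e₁) ∧
                  (∀ (z : B7Prop1Explicit.Site (F.P K).d) (κ τ : Fin (F.P K).d),
                    SideTouches (pullDom (fun j => if K - n ≤ j then ({x} : Set (Site (F.P K) 0)) else (∅ : Set (Site (F.P K) 0))) (K - n)) z τ →
                    ‖(((F.L : ℝ)⁻¹) ^ (K - n))⁻¹ •
                      (((A + Hs (C A)) - fun b : PBond (F.P K) 0 => ∑ c, flatH F n K (cubeSeqMT3 F n K x ρ S M hM) (Pi.single c 1) b •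
                          bondAvgIter (c.1.1 : ℕ) (A + Hs (C A)) c.1.2) ⟨(transl 0 z).shift κ, τ⟩ -
                        ((A + Hs (C A)) - fun b : PBond (F.P K) 0 => ∑ c, flatH F n K (cubeSeqMT3 F n K x ρ S M hM) (Pi.single c 1) b •
                          bondAvgIter (c.1.1 : ℕ) (A + Hs (C A)) c.1.2) ⟨transl 0 z, τ⟩)‖ ≤ e₁) ∧
                  (∀ (z : B7Prop1Explicit.Site (F.P K).d) (μ : Fin (F.P K).d),
                    BondTouches (pullDom (fun j => if K - n ≤ j then ({x} : Set (Site (F.P K) 0)) else (∅ : Set (Site (F.P K) 0))) (K - n)) z μ →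
                    ‖pdiv (((F.L : ℝ)⁻¹) ^ (K - n)) (1 : B7Prop1Explicit.Site (F.P K).d → Fin (F.P K).d → (Matrix (Fin 2) (Fin 2) ℂ)ˣ)
                        (plaqCovDeriv (((F.L : ℝ)⁻¹) ^ (K - n)) (1 : B7Prop1Explicit.Site (F.P K).d → Fin (F.P K).d → (Matrix (Fin 2) (Fin 2) ℂ)ˣ)
                          (pull ((A + Hs (C A)) - fun b : PBond (F.P K) 0 => ∑ c, flatH F n K (cubeSeqMT3 F n K x ρ S M hM) (Pi.single c 1) b •
                            bondAvgIter (c.1.1 : ℕ) (A + Hs (C A)) c.1.2) 0)) μ z‖ ≤ e₁)) ∧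
                ((∀ (z : B7Prop1Explicit.Site (F.P K).d) (τ : Fin (F.P K).d),
                    SideTouches (pullDom (fun j => if K - n ≤ j then ({x} : Set (Site (F.P K) 0)) else (∅ : Set (Site (F.P K) 0))) (K - n)) z τ →
                    ‖Hs (C A) ⟨transl 0 z, τ⟩‖ ≤ e₃) ∧
                  (∀ (z : B7Prop1Explicit.Site (F.P K).d) (κ τ : Fin (F.P K).d),
                    SideTouches (pullDom (fun j => if K - n ≤ j then ({x} : Set (Site (F.P K) 0)) else (∅ : Set (Site (F.P K) 0))) (K - n)) z τ →
                    ‖(((F.L : ℝ)⁻¹) ^ (K - n))⁻¹ • (Hs (C A) ⟨(transl 0 z).shift κ, τ⟩ - Hs (C A) ⟨transl 0 z, τ⟩)‖ ≤ e₃) ∧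
                  (∀ (z : B7Prop1Explicit.Site (F.P K).d) (μ : Fin (F.P K).d),
                    BondTouches (pullDom (fun j => if K - n ≤ j then ({x} : Set (Site (F.P K) 0)) else (∅ : Set (Site (F.P K) 0))) (K - n)) z μ →
                    ‖pdiv (((F.L : ℝ)⁻¹) ^ (K - n)) (1 : B7Prop1Explicit.Site (F.P K).d → Fin (F.P K).d → (Matrix (Fin 2) (Fin 2) ℂ)ˣ)
                        (plaqCovDeriv (((F.L : ℝ)⁻¹) ^ (K - n)) (1 : B7Prop1Explicit.Site (F.P K).d → Fin (F.P K).d → (Matrix (Fin 2) (Fin 2) ℂ)ˣ)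
                          (pull (Hs (C A)) 0)) μ z‖ ≤ e₃)) ∧
                (∀ c : BondIdx (cubeSeqMT3 F n K x ρ S M hM), (c.1.1 : ℕ) = K - n →
                  c.1.2.src ∈ (cubeSeqMT3 F n K x ρ S M hM).Om (c.1.1 : ℕ) → c.1.2.tgt ∈ (cubeSeqMT3 F n K x ρ S M hM).Om (c.1.1 : ℕ) →
                  ‖bondAvgIter (c.1.1 : ℕ) (A + Hs (C A)) c.1.2‖ ≤ 6 * ε₁ * (distSite (Mk (F.P K) (c.1.1 : ℕ)) c.1.2.src (iterBlockOf (c.1.1 : ℕ) x) + 1)) ∧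
                (∀ c : BondIdx (cubeSeqMT3 F n K x ρ S M hM),
                  ¬ ((c.1.1 : ℕ) = K - n ∧ c.1.2.src ∈ (cubeSeqMT3 F n K x ρ S M hM).Om (c.1.1 : ℕ) ∧
                      c.1.2.tgt ∈ (cubeSeqMT3 F n K x ρ S M hM).Om (c.1.1 : ℕ)) →
                  ‖bondAvgIter (c.1.1 : ℕ) (A + Hs (C A)) c.1.2‖ ≤ c₂ * (B₁ + 1) * ε₀ * (F.L : ℝ) ^ ((K - n) - (c.1.1 : ℕ))) ∧
                e₁ ≤ k₁ * (B₁ + 1) ^ 2 * ε₀ ^ 2 ∧ e₃ ≤ k₂ * (B₁ + 1) ^ 2 * ε₀ ^ 2) :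
    ∀ L : ℕ, 1 < L → ∃ (N : ℕ) (B₃ a₅ : ℝ), 4 < B₃ ∧ 0 < a₅ ∧
      ∀ F : T3Family, F.L = L → ∀ (n K : ℕ) (hnK : n < K), N ≤ F.L ^ (F.m + n) →
        ∀ (ε₀ ε₁ : ℝ), 0 < ε₁ → 0 < ε₀ → ε₀ ≤ a₅ →
          ∀ V : GaugeField (F.P n) 0 (Matrix.specialUnitaryGroup (Fin 2) ℂ), PlaqSmall ε₁ V →
            ∀ U ∈ regFibrePr F n K hnK.le ε₀ V,
              (∀ γ : ℝ → GaugeField (F.P K) 0 (Matrix.specialUnitaryGroup (Fin 2) ℂ), γ 0 = U → (∀ t, γ t ∈ fibre F ℰp n K hnK.le V) →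
                (∀ b, DifferentiableAt ℝ (fun t => ((γ t b : Matrix.specialUnitaryGroup (Fin 2) ℂ) : Matrix (Fin 2) (Fin 2) ℂ)) 0) →
                  deriv (fun t => wilsonAction4 (γ t)) 0 = 0) →
                RegPr F n K (max (B₃ * ε₁) (ε₀ / 2)) U := by
  intro L hL
  by_cases hodd : Odd L
  swap
  · -- even `L`: no member, the minimiser form is vacuous
    exact ⟨0, 5, 1, by norm_num, one_pos, fun F hF => absurd (hF ▸ F.hL.1) hodd⟩
  -- the P2 text and its constants
  obtain ⟨R₀, M₀, B₀, δ₀, B₃, hB₀, hδ₀, hB₃, hP2L⟩ := hP2 L hodd hL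
  -- the C_E thresholds (growth-exposed edition)
  obtain ⟨M₁, R₁, hCE₁⟩ := hCEgrowth L hodd hL R₀ M₀ B₀ δ₀ B₃ hB₀ hδ₀ hB₃ hP2L
  -- the P1♭ supplier's floors
  obtain ⟨Mₚ, Rₚ, hP1₁⟩ := hP1roomρ4 L hodd hL
  -- the geometry of the cube sequence: `M = L^{aₑ} ≥ max (max M₁ M₀) Mₚ`, `R = max (max R₁ R₀) (max 1 Rₚ)`, `S = R·M`
  set aₑ : ℕ := max (max M₁ M₀) Mₚ with haₑ
  set M : ℕ := L ^ aₑ with hMdef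
  have hL2 : 2 ≤ L := hL
  have hpow : aₑ ≤ L ^ aₑ := (Nat.lt_pow_self (by omega)).le
  have hM₁M : M₁ ≤ M := ((le_max_left _ _).trans (le_max_left _ _)).trans hpow
  have hM₀M : M₀ ≤ M := ((le_max_right _ _).trans (le_max_left _ _)).trans hpow
  have hMₚM : Mₚ ≤ M := (le_max_right _ _).trans hpow
  have hM1 : 1 ≤ M := Nat.one_le_pow _ _ (by omega)
  set R : ℕ := max (max R₁ R₀) (max 1 Rₚ) with hRdef
  have hR1 : 1 ≤ R := (le_max_left _ _).trans (le_max_right _ _)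
  have hRₚR : Rₚ ≤ R := (le_max_right _ _).trans (le_max_right _ _)
  set S : ℕ := R * M with hSdef
  -- P1♭'s BASE size constant `B₁` (read ρ-polynomially below), room letter and ρ-window constant (all ρ-free)
  obtain ⟨B₁, hB₁, Nr, Cρ, hCρ, qρ, hP1L⟩ := hP1₁ R M aₑ S hM1 rfl hMₚM hRₚR le_rfl
  -- the C_E floor letter and GROWTH constants (ρ-free, B₁-free)
  obtain ⟨Nce, k₁, k₂, c₂, ace, hk₁, hk₂, hc₂, hace, hCE₂⟩ :=
    hCE₁ R M aₑ S hM1 rfl hM₁M hM₀M ((le_max_left _ _).trans (le_max_left _ _)) ((le_max_right _ _).trans (le_max_left _ _)) le_rfl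
  -- the inner radius `ρ` by the POLYNOMIAL (163): the package constant grows at most linearly in `ρ` through `C₂ = c₂·(B₁(ρ+1) + 1)`
  have hBB : 0 < B₀ * B₃ := mul_pos hB₀ hB₃
  have hT₀ : 0 ≤ 4 * (B₀ * B₃) * (12 + c₂) + 8 := by positivity
  have hT₁ : 0 ≤ 4 * (B₀ * B₃) * (c₂ * B₁) := by positivity
  obtain ⟨ρ, hρ2, h163lin⟩ := exists_rho_163_pow hδ₀ hT₀ hT₁ qρ
  have hρ1 : 1 ≤ ρ := by
    have : (1 : ℝ) ≤ (ρ : ℝ) := by linarith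
    exact_mod_cast this
  have hρr1 : (1 : ℝ) ≤ ((ρ : ℝ) + 1) ^ qρ := one_le_pow₀ (by linarith)
  have hρr0 : (0 : ℝ) ≤ ((ρ : ℝ) + 1) ^ qρ := by positivity
  -- the size constant AT THIS `ρ` and the C_E constants it generates
  set B₁ρ : ℝ := B₁ * ((ρ : ℝ) + 1) ^ qρ with hB₁ρdef
  have hB₁ρ : 0 ≤ B₁ρ := mul_nonneg hB₁ hρr0
  set K₁ : ℝ := k₁ * (B₁ρ + 1) ^ 2 with hK₁def
  set K₂ : ℝ := k₂ * (B₁ρ + 1) ^ 2 with hK₂def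
  set C₂ : ℝ := c₂ * (B₁ρ + 1) with hC₂def
  set aCE : ℝ := ace / (B₁ρ + 1) with haCEdef
  have hK₁ : 0 ≤ K₁ := by positivity
  have hK₂ : 0 ≤ K₂ := by positivity
  have hC₂ : 0 ≤ C₂ := by positivity
  have haCE : 0 < aCE := by positivity
  -- the package constant `C′`
  set C' : ℝ := max (max 12 C₂) (2 / (B₀ * B₃)) with hC'def
  have hC'12 : (12 : ℝ) ≤ C' := (le_max_left _ _).trans (le_max_left _ _)
  have hC'C₂ : C₂ ≤ C' := (le_max_right _ _).trans (le_max_left _ _)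
  have hC'ce : 2 / (B₀ * B₃) ≤ C' := le_max_right _ _
  have hC'0 : 0 ≤ C' := by linarith
  have hCBB2 : (2 : ℝ) ≤ C' * (B₀ * B₃) := by
    have := (div_le_iff₀ hBB).1 hC'ce
    linarith
  -- `4C′B₀B₃ ≤ T₀ + T₁(ρ+1)` (`package_const_le`), hence (163) at this `ρ`
  have hTle : 4 * C' * B₀ * B₃ ≤ (4 * (B₀ * B₃) * (12 + c₂) + 8) + 4 * (B₀ * B₃) * (c₂ * B₁) * ((ρ : ℝ) + 1) ^ qρ := by
    rw [hC'def, hC₂def, hB₁ρdef]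
    exact package_const_le hBB hc₂ hB₁ hρr1
  have h163 : 4 * C' * B₀ * B₃ * Real.exp (-(δ₀ / 2 * ((ρ : ℝ) - 2))) ≤ 1 / 2 :=
    (mul_le_mul_of_nonneg_right hTle (Real.exp_pos _).le).trans h163lin
  -- the ratio `Cr = 4C′B₀B₃` and the ceiling `a` (after `ρ`)
  set Cr : ℝ := 4 * C' * B₀ * B₃ with hCrdef
  have hCr4ring : (4 : ℝ) * C' * B₀ * B₃ = 4 * (C' * (B₀ * B₃)) := by ring
  have hCr8 : (8 : ℝ) ≤ Cr := by rw [hCrdef, hCr4ring]; linarith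
  have hCr : 0 < Cr := by linarith
  have hρM : 0 < 12 * ((ρ : ℝ) + (M : ℝ)) := by positivity
  have hden : 0 < 16 * 3800 * ((5 * L : ℕ) : ℝ) ^ 2 * (L : ℝ) * (B₁ρ + 1) := by
    have : (0 : ℝ) < L := by exact_mod_cast (by omega : 0 < L)
    have : (0 : ℝ) < ((5 * L : ℕ) : ℝ) := by positivity
    positivity
  have hρ1C : 0 < Cρ * ((ρ : ℝ) + 1) ^ qρ := by positivity
  set a : ℝ := min (min aCE (min (Cr / (12 * ((ρ : ℝ) + (M : ℝ)))) (1 / (16 * 3800 * ((5 * L : ℕ) : ℝ) ^ 2 * (L : ℝ) * (B₁ρ + 1)))))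
    (1 / (Cρ * ((ρ : ℝ) + 1) ^ qρ)) with hadef
  have ha : 0 < a := lt_min (lt_min haCE (lt_min (div_pos hCr hρM) (div_pos one_pos hden))) (div_pos one_pos hρ1C)
  have haCE' : a ≤ aCE := (min_le_left _ _).trans (min_le_left _ _)
  have hreg₁ : 12 * ((ρ : ℝ) + (M : ℝ)) * a ≤ Cr := by
    have h1 : a ≤ Cr / (12 * ((ρ : ℝ) + (M : ℝ))) := (min_le_left _ _).trans ((min_le_right _ _).trans (min_le_left _ _))
    have := (le_div_iff₀ hρM).1 h1
    linarith
  have hreg₀ : 16 * 3800 * ((5 * L : ℕ) : ℝ) ^ 2 * (L : ℝ) * ((B₁ * ((ρ : ℝ) + 1) ^ qρ + 1) * a) ≤ 1 := by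
    have h1 : a ≤ 1 / (16 * 3800 * ((5 * L : ℕ) : ℝ) ^ 2 * (L : ℝ) * (B₁ρ + 1)) :=
      (min_le_left _ _).trans ((min_le_right _ _).trans (min_le_right _ _))
    have := (le_div_iff₀ hden).1 h1
    linarith
  -- the ρ-window (RULING L-11 v3): `Cρ·(ρ+1)^qρ·a ≤ 1` by the fourth `min`-term
  have hregρ : Cρ * ((ρ : ℝ) + 1) ^ qρ * a ≤ 1 := by
    have h1 : a ≤ 1 / (Cρ * ((ρ : ℝ) + 1) ^ qρ) := min_le_right _ _
    have := (le_div_iff₀ hρ1C).1 h1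
    linarith
  -- P1♭ at these constants, at the members with room
  have hCr4 : 4 < Cr := by linarith
  have hP1' := hP1L ρ a Cr hCr hCr4 hreg₁ hreg₀ hregρ
  -- the stub's constants: `B₃ := Cr`, `a₅ := exists_a5 (K₁ + K₂ + 1) a`, floor `N := max (2ρ + Nr) Nce`
  have hKc : (0 : ℝ) ≤ K₁ + K₂ + 1 := by positivity
  obtain ⟨a₅, ha₅, ha₅a, ha₅90, hKa⟩ := Prop8LastMile.exists_a5 hKc ha
  refine ⟨max (2 * ρ + Nr) Nce, Cr, a₅, hCr4, ha₅, ?_⟩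
  have hR₀R : R₀ ≤ R := (le_max_right R₁ R₀).trans (le_max_left _ _)
  have hS1 : 1 ≤ S := by
    show 1 ≤ R * M
    exact Nat.one_le_iff_ne_zero.mpr (Nat.mul_ne_zero (by omega) (by omega))
  have hRS : R * M ≤ S := le_rfl
  intro F hF n K hnK hN ε₀ ε₁ hε₁ hε₀ hε₀a₅ V hV U hU hstat
  have hNr : 2 * ρ + Nr ≤ F.L ^ (F.m + n) := (le_max_left _ _).trans hN
  have hNce : Nce ≤ F.L ^ (F.m + n) := (le_max_right _ _).trans hN
  have hUreg : RegPr F n K ε₀ U := ((mem_regFibrePr_iff F).mp hU).2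
  have hε₀a : ε₀ ≤ a := hε₀a₅.trans ha₅a
  -- P1♭ → (u, A) → hCEstat → the package → P2 at the cube sequence → the (167)-chart at every site → §1
  refine regPrHalving_of_memberCharts (Kc := K₁ + K₂ + 1) hCr hKc ha₅90 hKa hε₁ hε₀ hε₀a₅ U hUreg fun hreg x => ?_
  -- P1♭ at the member and the site
  obtain ⟨u, A, ho, hsa, htr, hii, hiii, hiv, hvi, hvii⟩ := hP1' F hF n K hnK hNr ε₀ ε₁ hε₁ hε₀ hε₀a hreg.le V hV U hU x
  have hii_mem : ∀ j, 1 ≤ j → j ≤ K - n → ∀ (z : B7Prop1Explicit.Site (F.P K).d) (μ : Fin (F.P K).d),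
      SideTouches (pullDom (fun i => {y : Site (F.P K) 0 | (cubeSeqMT3 F n K x ρ S M hM1).InOm i y}) j) z μ →
      (Unitary.toUnits (u (transl 0 z)))⁻¹ * unitsField (toUField U) ⟨transl 0 z, μ⟩ * Unitary.toUnits (u ((transl 0 z).shift μ)) =
        expUnit (I • ((((F.L : ℝ)⁻¹) ^ (K - n)) • A ⟨transl 0 z, μ⟩)) :=
    fun j h1 hjk z μ hz => hii z μ (sideTouches_subset_cube0 x ρ S M hM1 hS1 j h1 hjk z μ hz).1
      (sideTouches_subset_cube0 x ρ S M hM1 hS1 j h1 hjk z μ hz).2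
  -- the C_E rows
  obtain ⟨Hs, C, e₁, e₃, h165, h157, hnear, hfar, he₁, he₃⟩ :=
    hCE₂ B₁ρ hB₁ρ ρ hρ1 F hF n K hnK hNce ε₀ ε₁ hε₁ hε₀ (hε₀a.trans haCE') V hV U hU hstat x _ u A ho hsa htr hii hiii hiv hvi hvii
  -- the package at the site
  obtain ⟨u', A', A₁, Rm, B, hA, hchart, hdec, hnear', hfar', s₁, g₁, d₁, s₃, g₃, d₃⟩ :=
    sitePackage_of_rows x ρ S M hM1 U u A Hs C hsa (layerChart_of_memberChart hnK x ρ S M hM1 hii_mem) h165 h157 hnear hfar he₁ he₃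
  -- P2 at the cube sequence centred at `x`, with the canonical level weights
  have hAdm : Adm22 (cubeSeqMT3 F n K x ρ S M hM1) R M := adm22_cubeSeqMT3 F n K x ρ hM1 hRS
  have hw : IsLevWeight F n K (cubeSeqMT3 F n K x ρ S M hM1)
      (fun m b => ((F.L : ℝ) ^ levOf (fun j => {y : Site (F.P K) 0 | (cubeSeqMT3 F n K x ρ S M hM1).InOm j y}) (K - n) b.src *
        ((F.L : ℝ)⁻¹) ^ (K - n)) ^ m) := fun _ _ => rfl
  obtain ⟨H, Gt, hFH, -, -, -, -, dBI, hdom, h162, hHd⟩ :=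
    hP2L F hF n K hnK R M hR₀R hM₀M ⟨aₑ, hMdef⟩ (cubeSeqMT3 F n K x ρ S M hM1) rfl hAdm _ hw
  -- the text's `H` IS the canonical `flatH`
  have hHeq : H = flatH F n K (cubeSeqMT3 F n K x ρ S M hM1) :=
    LinearMap.ext fun X => funext fun b =>
      (hFH X b).trans (isFlatH_flatH (F := F) (n := n) (K := K) (D := cubeSeqMT3 F n K x ρ S M hM1) X b).symm
  rw [hHeq] at hHd
  -- the per-site clause of the (167)-chart schema
  have hε₀2 : 0 < ε₀ ^ 2 := by positivity
  have hρR : (0 : ℝ) ≤ (ρ : ℝ) - 2 := by linarith only [hρ2]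
  have h163' : 4 * C' * B₀ * B₃ * Real.exp (-(δ₀ / 2 * ((ρ : ℝ) - 2))) ≤ 1 / 2 := h163
  have hα₂ : K₁ * ε₀ ^ 2 + 1 / 4 * max (4 * C' * B₀ * B₃ * ε₁) (ε₀ / 2) + K₂ * ε₀ ^ 2 <
      1 / 4 * max (Cr * ε₁) (ε₀ / 2) + (K₁ + K₂ + 1) * ε₀ ^ 2 := by
    rw [hCrdef]; linarith only [hε₀2]
  exact siteClause_of_pieces_int hnK x ρ S M hM1 hw hdom hHd h162 hδ₀.le hB₀.le hB₃.le (C₁ := 6) (C := C') (by norm_num) (by linarith) hC'C₂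
    hε₁.le hε₀.le hρR h163' le_rfl hα₂ U u' hA hchart (fun _ => rfl) hdec hnear' hfar' s₁ g₁ d₁ s₃ g₃ d₃

end Door

/-! ## §2 ★★★ The one-hypothesis H door, ρ-window edition -/

open SmallMembersCoverLiftTangent (statLift)
open SmallMembersCoverLiftStub (stub_of_roomHalvingStat)
open HalvingStepOfPillarsRoomStatDoor (roomStubTextStat_of_roomHalvingStat)
open FlatOpsAdmAtMSAllL (hP2_holds)

/-- ★★★ **THE ONE-HYPOTHESIS H DOOR, ρ-WINDOW EDITION v3 + `4 < Cr` (prefix «ρ4», LEAD-H g6 small-`Cr` exit)**: the registered text of `BirthV10.stub_halvingStep`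
from the roomed P1♭ pillar `hP1roomρ4` ALONE — ✓`stub_halvingStep_of_hP1roomρ3`'s hypothesis with `4 < Cr →` inserted after `0 < Cr →`; the H-SMALL cover lift
(✓`statLift`), the P2 text (✓`hP2_holds`) and the growth-exposed C_E rows (✓`HalvingSitePackage.ceRows_of_chart_stat_growth_room`) discharged by name, as in ✓p653154.
INHABITABILITY (OWNER №9 (3)): supplier — ✓`hP1roomρ4_of_suppliers` ∘ ✓`hSupUρ4_of_memberPacks` ∘ (packs v2); door — kernel (§1: `Cr := 4C′B₀B₃ ≥ 8 > 4`).
[cite: Balaban1985Variational, Thm 1 p.279, (150)-(168) pp.301-304, Prop. 8 p.304; Balaban1985RegularSpaces, Thm 2 p.83, (1.33)-(1.38) p.82] -/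
theorem stub_halvingStep_of_hP1roomρ4
    (hP1roomρ4 : ∀ L : ℕ, Odd L → 1 < L → ∃ (Mₚ Rₚ : ℕ), ∀ (R M aₑ S : ℕ) (hM : 1 ≤ M), M = L ^ aₑ → Mₚ ≤ M → Rₚ ≤ R → R * M ≤ S →
      ∃ B₁ : ℝ, 0 ≤ B₁ ∧ ∃ Nr : ℕ, ∃ Cρ : ℝ, 0 < Cρ ∧ ∃ qρ : ℕ,
      ∀ (ρ : ℕ) (a Cr : ℝ), 0 < Cr → 4 < Cr → 12 * ((ρ : ℝ) + (M : ℝ)) * a ≤ Cr →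
        16 * 3800 * ((5 * L : ℕ) : ℝ) ^ 2 * (L : ℝ) * ((B₁ * ((ρ : ℝ) + 1) ^ qρ + 1) * a) ≤ 1 → Cρ * ((ρ : ℝ) + 1) ^ qρ * a ≤ 1 →
        ∀ F : T3Family, F.L = L → ∀ (n K : ℕ) (hnK : n < K), 2 * ρ + Nr ≤ F.L ^ (F.m + n) →
          ∀ (ε₀ ε₁ : ℝ), 0 < ε₁ → 0 < ε₀ → ε₀ ≤ a → Cr * ε₁ ≤ ε₀ →
          ∀ V : GaugeField (F.P n) 0 (Matrix.specialUnitaryGroup (Fin 2) ℂ), PlaqSmall ε₁ V →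
            ∀ U ∈ regFibrePr F n K hnK.le ε₀ V, ∀ x : Site (F.P K) 0,
              P1FlatPillarAt' F n K (cubeSeqMT3 F n K x ρ S M hM) (cubeSetM x (K - n) ρ S M 0) x ε₀ ε₁ (B₁ * ((ρ : ℝ) + 1) ^ qρ) 6
                (8 * (L : ℝ) * (B₁ * ((ρ : ℝ) + 1) ^ qρ + 1)) U) :
    ∀ (L : ℕ), 1 < L → ∃ B₃ : ℝ, 4 < B₃ ∧ ∃ a₅ : ℝ, 0 < a₅ ∧
      ∀ (i : Idx L) (ε₀ ε₁ : ℝ), 0 < ε₁ → ∀ (V : (famX L i).Bdry) (U : (famX L i).Cfg), (famX L i).Reg7 ε₁ V → (famX L i).InU ε₀ U →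
        (famX L i).InB V U → (famX L i).IsCritical V U → ε₀ ≤ a₅ → (famX L i).InU (max (B₃ * ε₁) (ε₀ / 2)) U :=
  stub_of_roomHalvingStat statLift (roomStubTextStat_of_roomHalvingStat (roomHalvingStat_of_rows_rho4 hP2_holds hP1roomρ4 ceRows_of_chart_stat_growth_room))


end Summit.QuantumFields.YangMills.Theorems.HalvingStubOfHP1RoomRho4

end
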